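import Literature.NumberTheory.IwasawaTheory.DivisionFieldTwoCyclotomicTowerNormKernel
import Literature.NumberTheory.IwasawaTheory.ZpExtensionNormKernelLayerPair
import Literature.NumberTheory.EllipticCurves.Rank1Residual.Predicates
import HarnessLib

/-!
# Non-square descent — THE HABITAT TOWER IN THE CRUX'S CURRENCY: for every curve with `GoodSS W 2` (good supersingular at `2`), `M = ℚ(W[2])`
# has ONE prime above `2`, every cyclotomic `ℤ₂`-tower over `M` has Fukuda index `0`, and `ker(N : Cl(M_n) → Cl(M)) = I_{Gal}·Cl(M_n)` at every
# level (Iwasawa's «`A_0 ≅ X/TX`» at finite level) — seed crux `SignedMuSeedAtTwoPlus` stmt-BirchSwinnertonDyer-21438 (parent Kμ⁺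
# `SignedMuVanishingAtTwoPlus` stmt-BirchSwinnertonDyer-20689, route ResidualThetaTransportAtTwo), line `nonsquare-descent`, stub S2

Cell `bsd-wall`, width seat `bsd-wall-rtt-p4-w2` g20 (`--supports`, closes nothing).  THEOREMS ONLY; BSD is not proved by this and the crux is
not advanced beyond its stub S2's arithmetic input «`A_k^χ ≅ X^χ/ω_k X^χ` (unique totally ramified prime, Washington 13.22)», which this file
delivers at the base of the tower for the FULL class group, by name, from the habitat hypothesis `GoodSS W 2` alone
(`Literature.NumberTheory.EllipticCurves.Rank1Residual.GoodSS W 2 = HasGoodReductionAtPrime 2 ∧ 2 ∣ a₂`; the crux's `W.frobeniusTrace 2 = 0` is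
stronger).  The tree theorems assembled: `IwasawaTheory.ker_classGroupNorm_layer_divisionField_two_eq_closure`,
`IwasawaTheory.totallyRamifiedFrom_zero_divisionField_two_of_dvd_frobeniusTraceAt`, `WeierstrassCurve.existsUnique_prime_divisionField_two_of_dvd_frobeniusTraceAt`
(Serre 1972 Prop. 12 at `p = 2`; Washington §13; Lang Ch. 5 §4 Thm. 4.1), and the currency bridge `LFunction_apply_prime_eq_frobeniusTrace` /
`lFunction_primesEquiv_eq_frobeniusTraceAt` / `hasGoodReductionAtPrime_primesEquiv_iff_holds`.

* `exists_place_two_of_goodSS` — `GoodSS W 2` ⟹ a place `v ∋ 2` of `ℚ` with `W.HasGoodReductionAt v` and `2 ∣ a_v(W)`.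
* **`existsUnique_prime_divisionField_two_of_goodSS`**, **`totallyRamifiedFrom_zero_divisionField_two_of_goodSS`**,
  **`ker_classGroupNorm_layer_divisionField_two_eq_closure_of_goodSS`** (base pair `M ⊆ M_n`), and
  **`ker_classGroupNorm_layer_layer_divisionField_two_eq_closure_of_goodSS`** (ANY two layers `M_k ⊆ M_j`, relative algebra structure
  `IntermediateField.inclusion (κ.layer_mono hkj)`; tree `ZpExtensionNormKernelLayerPair`).
* **`exists_topGenerator_pow_aut_divisionField_two_of_goodSS`** — THE NAMED-GENERATOR FORM «`ker(A_j → A_k) = ω_k A_j`, `ω_k = γ^{2^k} − 1`»: for any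
  compatible algebra structure `M_k → M_j` (the `IsScalarTower` hypothesis is spelled with the explicit `SMul` of that algebra structure: instance search for
  `SMul (κ.layer k) (κ.layer j)` over the concrete base `ℚ(W[2])` times out otherwise) and any topological generator `γ` of `κ` there is `σ ∈ Gal(M_j/M_k)`
  acting as `γ^{2^k}` on `M_j ⊆ M̄`,
  generating `Gal(M_j/M_k)`, with `N_{M_j/M_k} c = 1 ⟺ c = σ d / d` and its `2`-primary refinement (tree
  `IwasawaTheory.exists_topGenerator_pow_aut_forall_classGroupNorm_eq_one_iff`).

[folklore]
-/

set_option autoImplicit false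
-- the Theorems namespace of this sub repeats the summit name by design (D-0017 nested layout)
set_option linter.dupNamespace false

noncomputable section

open scoped NumberField
open NumberField IsDedekindDomain
open Literature.NumberTheory.EllipticCurves Literature.NumberTheory.GaloisRepresentations Literature.NumberTheory.NumberFields
  Literature.NumberTheory.EllipticCurves.Rank1Residual Literature.NumberTheory.IwasawaTheory

namespace Summit.BirchSwinnertonDyer.BirchSwinnertonDyer.Theorems.SignedMuAtTwo.NonsquareDescent

/-- **Bridge from the habitat currency `GoodSS W 2` to the place `v ∋ 2` of `ℚ`**: there is a height-one prime `v` of `𝓞 ℚ` containing `2` at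
which `W` has good reduction with `2 ∣ a_v(W)` (`a_v = a₂`: tree `LFunction_apply_prime_eq_frobeniusTrace`, `lFunction_primesEquiv_eq_frobeniusTraceAt`,
`hasGoodReductionAtPrime_primesEquiv_iff_holds`). [folklore] -/
theorem exists_place_two_of_goodSS (W : WeierstrassCurve ℚ) [W.IsElliptic] [W.IsGloballyMinimal]
    (h : haveI : Fact (Nat.Prime 2) := ⟨Nat.prime_two⟩; GoodSS W 2) :
    ∃ v : HeightOneSpectrum (𝓞 ℚ), ((2 : ℕ) : 𝓞 ℚ) ∈ v.asIdeal ∧ W.HasGoodReductionAt v ∧ (2 : ℤ) ∣ W.frobeniusTraceAt v := by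
  haveI : Fact (Nat.Prime 2) := ⟨Nat.prime_two⟩
  set v : HeightOneSpectrum (𝓞 ℚ) := Rat.HeightOneSpectrum.primesEquiv.symm ⟨2, Nat.prime_two⟩ with hvdef
  have hv2 : (Rat.HeightOneSpectrum.primesEquiv v : ℕ) = 2 := by
    rw [hvdef, Equiv.apply_symm_apply]
  have hgen : Rat.HeightOneSpectrum.natGenerator v = 2 := hv2
  have hmem : ((2 : ℕ) : 𝓞 ℚ) ∈ v.asIdeal := by
    rw [Rat.natCast_mem_asIdeal_iff, hgen]
  have hgood : W.HasGoodReductionAt v := (WeierstrassCurve.hasGoodReductionAtPrime_primesEquiv_iff_holds W v 2 hv2).mp h.1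
  refine ⟨v, hmem, hgood, ?_⟩
  have h1 := W.lFunction_primesEquiv_eq_frobeniusTraceAt hgood
  rw [hv2, WeierstrassCurve.LFunction_apply_prime_eq_frobeniusTrace W 2 h.1] at h1
  rw [← h1]
  exact h.2

/-- **`ℚ(W[2])` has exactly one prime above `2` for every `W` with `GoodSS W 2`** (Serre Prop. 12 (d) at `p = 2`).
[cite: SerreInventiones1972, §1.11 Prop. 12 (d)] -/
theorem existsUnique_prime_divisionField_two_of_goodSS (W : WeierstrassCurve ℚ) [W.IsElliptic] [W.IsGloballyMinimal]
    (h : haveI : Fact (Nat.Prime 2) := ⟨Nat.prime_two⟩; GoodSS W 2) :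
    haveI : NumberField (W.divisionField 2) := NumberField.mk
    ∃! w : HeightOneSpectrum (𝓞 (W.divisionField 2)), ((2 : ℕ) : 𝓞 (W.divisionField 2)) ∈ w.asIdeal := by
  obtain ⟨v, hv, hgood, hss⟩ := exists_place_two_of_goodSS W h
  exact W.existsUnique_prime_divisionField_two_of_dvd_frobeniusTraceAt v hv hgood hss

/-- **Fukuda's index is `0` for every cyclotomic `ℤ₂`-extension of `ℚ(W[2])`, for every `W` with `GoodSS W 2`.**
[cite: Washington1997, §13.1 Lemma 13.3] [cite: SerreInventiones1972, §1.11 Prop. 12 (c)] -/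
theorem totallyRamifiedFrom_zero_divisionField_two_of_goodSS (W : WeierstrassCurve ℚ) [W.IsElliptic] [W.IsGloballyMinimal]
    (h : haveI : Fact (Nat.Prime 2) := ⟨Nat.prime_two⟩; GoodSS W 2) :
    haveI : NumberField (W.divisionField 2) := NumberField.mk
    ∀ κ : ZpExtension (W.divisionField 2) 2, κ.IsCyclotomic → TotallyRamifiedFrom κ 0 := by
  obtain ⟨v, hv, hgood, hss⟩ := exists_place_two_of_goodSS W h
  exact totallyRamifiedFrom_zero_divisionField_two_of_dvd_frobeniusTraceAt W v hv hgood hss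

/-- **Iwasawa's kernel theorem on the habitat tower, in the crux's currency.**  For every `W/ℚ` with `GoodSS W 2`, every cyclotomic `ℤ₂`-extension
`κ` of `M = ℚ(W[2])` and every `n`: `ker (N : Cl(M_n) → Cl(M)) = I_{Gal(M_n/M)} · Cl(M_n)` — the input «`A_0 ≅ X/TX`» (Washington Prop. 13.22 / Lang
Ch. 5 §4 Thm. 4.1 (iii)) of stub S2 of line `nonsquare-descent`, read at the finite level `n`, for the FULL class groups, UNCONDITIONALLY.
[cite: Washington1997, §13.3 Lemma 13.15 and Prop. 13.22] [cite: Lang1990, Ch. 5 §4 Thm. 4.1 (iii) and Corollary] -/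
theorem ker_classGroupNorm_layer_divisionField_two_eq_closure_of_goodSS (W : WeierstrassCurve ℚ) [W.IsElliptic] [W.IsGloballyMinimal]
    (h : haveI : Fact (Nat.Prime 2) := ⟨Nat.prime_two⟩; GoodSS W 2) :
    haveI : NumberField (W.divisionField 2) := NumberField.mk
    ∀ (κ : ZpExtension (W.divisionField 2) 2), κ.IsCyclotomic → ∀ (n : ℕ) [NumberField (κ.layer n)],
      (classGroupNorm (W.divisionField 2) (κ.layer n)).ker = Subgroup.closure {x : ClassGroup (𝓞 (κ.layer n)) |
        ∃ (τ : (κ.layer n) ≃ₐ[W.divisionField 2] (κ.layer n)) (d : ClassGroup (𝓞 (κ.layer n))),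
          x = ClassGroup.mulEquiv (AmbiguousClass.intAut τ) d / d} := by
  obtain ⟨v, hv, hgood, hss⟩ := exists_place_two_of_goodSS W h
  exact ker_classGroupNorm_layer_divisionField_two_eq_closure W v hv hgood hss

/-- **Iwasawa's kernel theorem between ANY two layers `M_k ⊆ M_j` of the habitat tower.**  For every `W/ℚ` with `GoodSS W 2`, every cyclotomic
`ℤ₂`-extension `κ` of `M = ℚ(W[2])` and all `k ≤ j` (the inclusion `M_k ⊆ M_j` as algebra structure):
`ker (N : Cl(M_j) → Cl(M_k)) = I_{Gal(M_j/M_k)} · Cl(M_j)` — «`A_k ≅ A_j / ω_k A_j`», Washington Prop. 13.22 between finite levels, UNCONDITIONALLY.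
[cite: Washington1997, §13.3 Lemma 13.15 and Prop. 13.22] [cite: Lang1990, Ch. 5 §4 Thm. 4.1 and Corollary] -/
theorem ker_classGroupNorm_layer_layer_divisionField_two_eq_closure_of_goodSS (W : WeierstrassCurve ℚ) [W.IsElliptic] [W.IsGloballyMinimal]
    (h : haveI : Fact (Nat.Prime 2) := ⟨Nat.prime_two⟩; GoodSS W 2) :
    haveI : NumberField (W.divisionField 2) := NumberField.mk
    ∀ (κ : ZpExtension (W.divisionField 2) 2), κ.IsCyclotomic → ∀ {k j : ℕ} (hkj : k ≤ j) [NumberField (κ.layer k)] [NumberField (κ.layer j)],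
      letI : Algebra (κ.layer k) (κ.layer j) := (IntermediateField.inclusion (κ.layer_mono hkj)).toRingHom.toAlgebra
      (classGroupNorm (κ.layer k) (κ.layer j)).ker = Subgroup.closure {x : ClassGroup (𝓞 (κ.layer j)) |
        ∃ (τ : (κ.layer j) ≃ₐ[κ.layer k] (κ.layer j)) (d : ClassGroup (𝓞 (κ.layer j))),
          x = ClassGroup.mulEquiv (AmbiguousClass.intAut τ) d / d} := by
  haveI : NumberField (W.divisionField 2) := NumberField.mk
  intro κ hκ k j hkj _ _
  haveI : Fact (Nat.Prime 2) := ⟨Nat.prime_two⟩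
  obtain ⟨v, hv, hgood, hss⟩ := exists_place_two_of_goodSS W h
  obtain ⟨v₀, hv₀, huniq⟩ := W.existsUnique_prime_divisionField_two_of_dvd_frobeniusTraceAt v hv hgood hss
  exact ker_classGroupNorm_layer_layer_eq_closure_of_totallyRamifiedFrom_zero κ
    (totallyRamifiedFrom_zero_divisionField_two_of_dvd_frobeniusTraceAt W v hv hgood hss κ hκ) v₀ (fun w hw => huniq w hw) hkj

/-- **The named-generator form on the habitat tower — «`ker(A_j → A_k) = ω_k A_j`, `ω_k = γ^{2^k} − 1`».**  For every `W/ℚ` with `GoodSS W 2`, every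
cyclotomic `ℤ₂`-extension `κ` of `M = ℚ(W[2])` with topological generator `γ` (`κ γ = 1`), all `k ≤ j` and ANY algebra structure `M_k → M_j` compatible
with `M`: there is `σ ∈ Gal(M_j/M_k)` acting on `M_j ⊆ M̄` as `γ^{2^k}` and generating `Gal(M_j/M_k)`, such that a class `c` of `M_j` has
`N_{M_j/M_k} c = 1` iff `c = σ d / d`, and a `2`-primary such `c` is `σ d / d` with `d` `2`-primary — UNCONDITIONALLY.
[cite: Washington1997, §13.1 and §13.3 Lemma 13.15, Prop. 13.22] [cite: Lang1990, Ch. 5 §4 Thm. 4.1 and Corollary] -/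
theorem exists_topGenerator_pow_aut_divisionField_two_of_goodSS (W : WeierstrassCurve ℚ) [W.IsElliptic] [W.IsGloballyMinimal]
    (h : haveI : Fact (Nat.Prime 2) := ⟨Nat.prime_two⟩; GoodSS W 2) :
    haveI : NumberField (W.divisionField 2) := NumberField.mk
    ∀ (κ : ZpExtension (W.divisionField 2) 2), κ.IsCyclotomic → ∀ {γ : Field.absoluteGaloisGroup (W.divisionField 2)}, κ.IsTopGenerator γ →
      ∀ {k j : ℕ}, k ≤ j → ∀ [NumberField (κ.layer k)] [NumberField (κ.layer j)] [inst : Algebra (κ.layer k) (κ.layer j)]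
        [@IsScalarTower (W.divisionField 2) (κ.layer k) (κ.layer j) _ inst.toSMul _],
      ∃ σ : (κ.layer j) ≃ₐ[κ.layer k] (κ.layer j),
        (∀ x : κ.layer j, ((σ x : κ.layer j) : AlgebraicClosure (W.divisionField 2)) = (γ ^ 2 ^ k) • (x : AlgebraicClosure (W.divisionField 2))) ∧
        Subgroup.zpowers σ = ⊤ ∧
        (∀ c : ClassGroup (𝓞 (κ.layer j)), classGroupNorm (κ.layer k) (κ.layer j) c = 1 ↔
          ∃ d : ClassGroup (𝓞 (κ.layer j)), c = ClassGroup.mulEquiv (AmbiguousClass.intAut σ) d / d) ∧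
        (∀ {m : ℕ} {c : ClassGroup (𝓞 (κ.layer j))}, c ^ 2 ^ m = 1 → classGroupNorm (κ.layer k) (κ.layer j) c = 1 →
          ∃ d : ClassGroup (𝓞 (κ.layer j)), d ^ 2 ^ (Fintype.card (ClassGroup (𝓞 (κ.layer j)))).factorization 2 = 1 ∧
            c = ClassGroup.mulEquiv (AmbiguousClass.intAut σ) d / d) := by
  haveI : NumberField (W.divisionField 2) := NumberField.mk
  intro κ hκ γ hγ k j hkj _ _ _ _
  haveI : Fact (Nat.Prime 2) := ⟨Nat.prime_two⟩
  obtain ⟨v, hv, hgood, hss⟩ := exists_place_two_of_goodSS W h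
  obtain ⟨v₀, hv₀, huniq⟩ := W.existsUnique_prime_divisionField_two_of_dvd_frobeniusTraceAt v hv hgood hss
  exact exists_topGenerator_pow_aut_forall_classGroupNorm_eq_one_iff κ
    (totallyRamifiedFrom_zero_divisionField_two_of_dvd_frobeniusTraceAt W v hv hgood hss κ hκ) v₀ (fun w hw => huniq w hw) hγ hkj

end Summit.BirchSwinnertonDyer.BirchSwinnertonDyer.Theorems.SignedMuAtTwo.NonsquareDescent

end
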